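import Summits.CriticalPhenomena.PercolationContinuityZ3.Theorems.PercNearOneGluingNoHeavyLowerTailSahiStrongDaykin
import Mathlib.Combinatorics.SetFamily.FourFunctions
import Mathlib.Tactic
import HarnessLib

/-!
# `NoHeavyLowerTail` (crux stmt-CriticalPhenomena-4575), master-family line P1 (gen 28):
# the distinct-pairs Ahlswede–Daykin inequality on an arbitrary finite distributive lattice

Support file (seat `prim-masterthm-p1`, gen 28; `--supports stmt-CriticalPhenomena-4575`).  Two definitions (`pairSupsL`, `pairInfsL`: joins and meets
of pairs of DISTINCT members of a finset in a lattice), no `sorry`, standard axioms.  Transfers gen 28's Theorem A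
(`…SahiStrongDaykin.sq_sum_le_of_logSupermodular`, stated on a powerset algebra) to every distributive lattice through Birkhoff's representation
theorem, exactly as Mathlib transfers `Finset.four_functions_theorem` to `four_functions_theorem`:
* `sq_sum_le_of_logSupermodular_lattice`: for `w ≥ 0` log-supermodular on a distributive lattice (`w a · w b ≤ w (a ⊓ b) · w (a ⊔ b)`) and any finset `s`,
  `(Σ_s w)² ≤ Σ_s w² + 2·(Σ_{pairInfsL s} w)·(Σ_{pairSupsL s} w)`;
* `card_choose_two_le_lattice`: `#s·(#s−1) ≤ 2·#pairInfsL s·#pairSupsL s` — for `m` distinct elements of a distributive lattice the numbers of distinct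
  pairwise meets and joins of distinct pairs have product at least `m(m−1)/2`.
Memo `run/shared/lean/prim/prim-masterthm/FROM-prim-masterthm-p1-g28-STRONG-DAYKIN.md` §0. [this work]
-/

namespace Summit.CriticalPhenomena.PercolationContinuityZ3.Theorems.SahiStrongDaykin

open Finset Function
open scoped FinsetFamily

section Lattice

variable {L M : Type*} [Lattice L] [Lattice M] [DecidableEq L] [DecidableEq M]

/-- Joins `a ⊔ b` of pairs of DISTINCT members of `s`. [this work] -/
def pairSupsL (s : Finset L) : Finset L := s.offDiag.image fun p => p.1 ⊔ p.2

/-- Meets `a ⊓ b` of pairs of DISTINCT members of `s`. [this work] -/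
def pairInfsL (s : Finset L) : Finset L := s.offDiag.image fun p => p.1 ⊓ p.2

/-- On a powerset algebra `pairSupsL` is the `pairSups` of `…SahiStrongDaykin`. [this work] -/
theorem pairSupsL_eq_pairSups {β : Type*} [DecidableEq β] (𝒮 : Finset (Finset β)) : pairSupsL 𝒮 = pairSups 𝒮 := rfl

/-- On a powerset algebra `pairInfsL` is `pairInfs`. [this work] -/
theorem pairInfsL_eq_pairInfs {β : Type*} [DecidableEq β] (𝒮 : Finset (Finset β)) : pairInfsL 𝒮 = pairInfs 𝒮 := rfl

/-- `pairSupsL` commutes with injective lattice homomorphisms. [this work] -/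
theorem map_pairSupsL (f : LatticeHom L M) (hf : Injective f) (s : Finset L) :
    (pairSupsL s).map ⟨f, hf⟩ = pairSupsL (s.map ⟨f, hf⟩) := by
  ext x
  simp only [pairSupsL, mem_map, mem_image, mem_offDiag, Embedding.coeFn_mk, Prod.exists]
  constructor
  · rintro ⟨y, ⟨a, b, ⟨ha, hb, hab⟩, rfl⟩, rfl⟩
    exact ⟨f a, f b, ⟨⟨a, ha, rfl⟩, ⟨b, hb, rfl⟩, fun h => hab (hf h)⟩, (map_sup f a b).symm⟩
  · rintro ⟨x1, x2, ⟨⟨a, ha, rfl⟩, ⟨b, hb, rfl⟩, hab⟩, rfl⟩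
    exact ⟨a ⊔ b, ⟨a, b, ⟨ha, hb, fun h => hab (congrArg f h)⟩, rfl⟩, map_sup f a b⟩

/-- `pairInfsL` commutes with injective lattice homomorphisms. [this work] -/
theorem map_pairInfsL (f : LatticeHom L M) (hf : Injective f) (s : Finset L) :
    (pairInfsL s).map ⟨f, hf⟩ = pairInfsL (s.map ⟨f, hf⟩) := by
  ext x
  simp only [pairInfsL, mem_map, mem_image, mem_offDiag, Embedding.coeFn_mk, Prod.exists]
  constructor
  · rintro ⟨y, ⟨a, b, ⟨ha, hb, hab⟩, rfl⟩, rfl⟩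
    exact ⟨f a, f b, ⟨⟨a, ha, rfl⟩, ⟨b, hb, rfl⟩, fun h => hab (hf h)⟩, (map_inf f a b).symm⟩
  · rintro ⟨x1, x2, ⟨⟨a, ha, rfl⟩, ⟨b, hb, rfl⟩, hab⟩, rfl⟩
    exact ⟨a ⊓ b, ⟨a, b, ⟨ha, hb, fun h => hab (congrArg f h)⟩, rfl⟩, map_inf f a b⟩

end Lattice

section DistribLattice

variable {L : Type*} [DistribLattice L] [DecidableEq L]

/-- Transfer step: the inequality on a FINITE distributive lattice, via a Birkhoff embedding into a powerset algebra. [this work] -/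
private theorem sq_sum_le_aux {L : Type*} [DistribLattice L] [DecidableEq L] [Finite L] (w : L → ℝ) (hw₀ : ∀ a, 0 ≤ w a)
    (hw : ∀ a b, w a * w b ≤ w (a ⊓ b) * w (a ⊔ b)) (s : Finset L) :
    (∑ a ∈ s, w a) ^ 2 ≤ ∑ a ∈ s, w a ^ 2 + 2 * ((∑ a ∈ pairInfsL s, w a) * ∑ a ∈ pairSupsL s, w a) := by
  obtain ⟨β, _, _, g, hg⟩ := exists_birkhoff_representation L
  set w' : Finset β → ℝ := extend g w 0 with hw'
  have hw'g : ∀ a, w' (g a) = w a := fun a => hg.extend_apply _ _ _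
  have hw'0 : ∀ t, 0 ≤ w' t := fun t => by
    by_cases h : ∃ a, g a = t
    · obtain ⟨a, rfl⟩ := h; rw [hw'g]; exact hw₀ a
    · rw [hw', extend_apply' _ _ _ h]; exact le_rfl
  have hmod : ∀ x ⊆ (univ : Finset β), ∀ y ⊆ (univ : Finset β), w' x * w' y ≤ w' (x ∩ y) * w' (x ∪ y) := by
    intro x _ y _
    by_cases hx : ∃ a, g a = x
    · by_cases hy : ∃ b, g b = y
      · obtain ⟨a, rfl⟩ := hx; obtain ⟨b, rfl⟩ := hy
        rw [← inf_eq_inter, ← sup_eq_union, ← map_inf, ← map_sup, hw'g, hw'g, hw'g, hw'g]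
        exact hw a b
      · rw [hw', extend_apply' _ _ _ hy, Pi.zero_apply, mul_zero]
        exact mul_nonneg (hw'0 _) (hw'0 _)
    · rw [hw', extend_apply' _ _ _ hx, Pi.zero_apply, zero_mul]
      exact mul_nonneg (hw'0 _) (hw'0 _)
  have h := sq_sum_le_of_logSupermodular (univ : Finset β) (s.map ⟨g, hg⟩) w' hw'0 hmod
    (fun x _ => mem_powerset.2 (subset_univ x))
  rw [← pairSupsL_eq_pairSups, ← pairInfsL_eq_pairInfs, ← map_pairSupsL g hg, ← map_pairInfsL g hg] at h
  simp only [sum_map, Embedding.coeFn_mk, hw'g] at h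
  exact h

/-- **Distinct-pairs Ahlswede–Daykin on any distributive lattice (weighted).**  For `w ≥ 0` log-supermodular and any finset `s`:
`(Σ_s w)² ≤ Σ_s w² + 2·w(pairInfsL s)·w(pairSupsL s)`. [this work] -/
theorem sq_sum_le_of_logSupermodular_lattice (w : L → ℝ) (hw₀ : ∀ a, 0 ≤ w a)
    (hw : ∀ a b, w a * w b ≤ w (a ⊓ b) * w (a ⊔ b)) (s : Finset L) :
    (∑ a ∈ s, w a) ^ 2 ≤ ∑ a ∈ s, w a ^ 2 + 2 * ((∑ a ∈ pairInfsL s, w a) * ∑ a ∈ pairSupsL s, w a) := by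
  -- restrict to the finite sublattice generated by `s`
  set S : Sublattice L := ⟨latticeClosure (s : Set L), isSublattice_latticeClosure.1, isSublattice_latticeClosure.2⟩ with hS
  have : Finite S := (s.finite_toSet.latticeClosure).to_subtype
  set s' : Finset S := s.preimage (↑) Subtype.coe_injective.injOn with hs'def
  have hs' : s'.map ⟨S.subtype, Subtype.coe_injective⟩ = s := by
    ext a
    simp only [hs'def, mem_map, mem_preimage, Embedding.coeFn_mk, Subtype.exists, Sublattice.coe_subtype, exists_and_right,
      exists_eq_right]
    constructor
    · rintro ⟨_, ha⟩; exact ha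
    · intro ha; exact ⟨subset_latticeClosure (mem_coe.2 ha), ha⟩
  have haux := sq_sum_le_aux (L := S) (w ∘ (↑)) (fun a => hw₀ a) (fun a b => hw a b) s'
  rw [← hs', ← map_pairSupsL S.subtype Subtype.coe_injective, ← map_pairInfsL S.subtype Subtype.coe_injective]
  simp only [sum_map, Embedding.coeFn_mk, Sublattice.coe_subtype]
  exact haux

/-- **Counting form on any distributive lattice**: for `m` distinct elements, `m(m−1) ≤ 2·#pairInfsL·#pairSupsL`. [this work] -/
theorem card_choose_two_le_lattice (s : Finset L) : #s * (#s - 1) ≤ 2 * (#(pairInfsL s) * #(pairSupsL s)) := by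
  have h := sq_sum_le_of_logSupermodular_lattice (fun _ => (1 : ℝ)) (fun _ => zero_le_one) (fun _ _ => by norm_num) s
  simp only [sum_const, nsmul_eq_mul, mul_one, one_pow] at h
  rcases Nat.eq_zero_or_pos #s with h0 | hpos
  · rw [h0]; simp
  · have : ((#s * (#s - 1) : ℕ) : ℝ) ≤ ((2 * (#(pairInfsL s) * #(pairSupsL s)) : ℕ) : ℝ) := by
      push_cast
      rw [Nat.cast_sub hpos, Nat.cast_one]
      nlinarith [h]
    exact_mod_cast this

end DistribLattice

end Summit.CriticalPhenomena.PercolationContinuityZ3.Theorems.SahiStrongDaykin
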